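import Summits.QuantumFields.YangMills.Theses.SqueezedSkewness
import Summits.QuantumFields.YangMills.Theorems.SqueezedSkewnessThermalLimit
import HarnessLib

/-!
# Route `SqueezedSkewness`, crux `VacuumDomination` (stmt-QuantumFields-28192): the REGISTERED STUB `stub_thermalLimit`
# BY NAME AND SIGNATURE

The BC3 birth skeleton `Cruxes/NT/Lines/vacuum_domination_birth.lean` (planner ym-idea-6 g7, LINE A) registers two stubs on
item 28192: `stub_thermalLimit : ThermalLimit` (engine: the reflection form `Qrp β (2L+1) (2^k (2L+1)) s f` converges along
the period-doubling chain) and `stub_limitDomination : LimitDomination` (the Källén–Lehmann content), composed by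
`VacuumDomination_of`.  The skeleton's `def ThermalLimit` is CHARACTER-IDENTICAL to the route decl
`Theses.SqueezedSkewness.ThermalLimit` (item stmt-QuantumFields-22661, the later «KL split» of the same crux), which is PROVED in
the tree: `Theorems.SqueezedSkewnessThermalLimit.thermalLimit_proof` (width seat ym-t4-w9, p653465; engine files
`…ThermalLimitSpectralSums`, `…FinTorusSlabCycle`, `…FinTorusWindow`, `…Plaquettes`, `…Windows`).  This file reproduces the
name-keyed statement verbatim (in its own namespace) and serves the registered stub `theorem stub_thermalLimit : ThermalLimit`
from that proof, so 28192's skeleton is `VacuumDomination ⇐ stub_limitDomination` only (`vacuumDomination_of_limitDomination`).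

Seat `ym-line-fcl-p3` g15 (cell ym-idea-1; free hands).  THEOREMS + one verbatim abbrev; no new mathematics.  HONEST FRAMING:
`stub_limitDomination` (L, Källén–Lehmann domination) is NOT proved; no crux, NT statement, rung or mass gap is proved.
[cite: OsterwalderSeilerAnnPhys1978, §2–3] [cite: MontvayMunster1994, §3.2.6]
-/

set_option autoImplicit false

namespace Summit.QuantumFields.YangMills.Theorems.SqueezedSkewnessVacuumDominationStub

/-- Statement of the registered stub `stub_thermalLimit` of crux 28192 — VERBATIM the skeleton's `def ThermalLimit`
(= `Theses.SqueezedSkewness.ThermalLimit`, item stmt-QuantumFields-22661). -/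
abbrev ThermalLimit : Prop :=
  Summit.QuantumFields.YangMills.Theses.SqueezedSkewness.ThermalLimit

/-- Statement of the registered stub `stub_limitDomination` of crux 28192 — VERBATIM the skeleton's `def LimitDomination`. -/
abbrev LimitDomination : Prop :=
  ∀ (G : Type) [Group G] [TopologicalSpace G] [IsTopologicalGroup G] [CompactSpace G], letI : MeasurableSpace G := borel G; haveI : BorelSpace G := ⟨rfl⟩; ∀ (r : Literature.MathematicalPhysics.QuantumFieldTheory.LatticeRep G), let St : ℕ → ℕ → Type := fun S T => Literature.MathematicalPhysics.QuantumFieldTheory.FinTorusSite S S S T; let Cfg : ℕ → ℕ → Type := fun S T => Literature.MathematicalPhysics.QuantumFieldTheory.FinTorusSite S S S T × Fin 4 → G; let cc : (n : ℕ) → Fin n → ℤ := fun n i => if 2 * i.val < n then (i.val : ℤ) else (i.val : ℤ) - n; let posE : (S T : ℕ) → St S T → EuclideanSpace ℝ (Fin 4) := fun S T x => Literature.MathematicalPhysics.QuantumLattice.siteToE (d := 4) ![cc T x.2.2.2, cc S x.1, cc S x.2.1, cc S x.2.2.1]; let P : (S T : ℕ) → St S T → Fin 4 → Fin 4 → Cfg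 S T → ℝ := fun _ _ x i j U => (r.ρ (Literature.MathematicalPhysics.QuantumFieldTheory.finTorusPlaquette U x i j)).trace.re; let A : (S T : ℕ) → St S T → Cfg S T → ℝ := fun S T x U => ∑ q : {q : Fin 4 × Fin 4 // q.1 < q.2}, P S T x q.1.1 q.1.2 U; let w : ℝ → (S T : ℕ) → Cfg S T → ℝ := fun β S T U => Real.exp (-β * ∑ x : St S T, ∑ q : {q : Fin 4 × Fin 4 // q.1 < q.2}, ((r.N : ℝ) - P S T x q.1.1 q.1.2 U)); let E : ℝ → (S T : ℕ) → (Cfg S T → ℝ) → ℝ := fun β S T F => (∫ U : Literature.MathematicalPhysics.QuantumFieldTheory.FinTorusSite S S S T × Fin 4 → G, F U * w β S T U ∂MeasureTheory.Measure.pi (fun _ => Literature.MathematicalPhysics.QuantumFieldTheory.haarProbability G)) / Literature.MathematicalPhysics.QuantumFieldTheory.wilsonFinTorusPartition r.ρ β S S S T; let Cov : ℝ → (S T : ℕ) → (Cfg S T → ℝ) → (Cfg S T → ℝ) → ℝ := fun β S T F F' => E β S T (fun U => F U * F' U) - E β S T F * E β S T F'; let refl : (S T : ℕ) → Cfg S T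 → Cfg S T := fun _ T U e => if e.2 = Fin.last 3 then (U ((e.1.1, e.1.2.1, e.1.2.2.1, Fin.rev e.1.2.2.2), Fin.last 3))⁻¹ else U ((e.1.1, e.1.2.1, e.1.2.2.1, ⟨(T - e.1.2.2.2.val) % T, Nat.mod_lt _ e.1.2.2.2.pos⟩), e.2); let B : (S T : ℕ) → ℝ → SchwartzMap (EuclideanSpace ℝ (Fin 4)) ℝ → Cfg S T → ℝ := fun S T s f U => ∑ x : St S T, f (s • posE S T x) * A S T x U; let Qrp : ℝ → (S T : ℕ) → ℝ → SchwartzMap (EuclideanSpace ℝ (Fin 4)) ℝ → ℝ := fun β S T s f => Cov β S T (fun U => B S T s f (refl S T U)) (B S T s f); let LF : ℝ → SchwartzMap (EuclideanSpace ℝ (Fin 4)) ℝ → ℝ → (Fin 3 → ℝ) → ℂ := fun s f E p => ∑' x : Fin 4 → ℤ, (((f (s • Literature.MathematicalPhysics.QuantumLattice.siteToE (d := 4) x) * Real.exp (-(E * (s * (x 0 : ℝ))))) : ℝ) : ℂ) * Complex.exp (Complex.I * ((s * ∑ k : Fin 3, p k * (x k.succ : ℝ) : ℝ) : ℂ)); ∀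 (β : ℝ) (L : ℕ) (s R c : ℝ) (f g : SchwartzMap (EuclideanSpace ℝ (Fin 4)) ℝ), 0 ≤ β → 1 ≤ L → 0 < s → 0 ≤ c → tsupport (f : EuclideanSpace ℝ (Fin 4) → ℝ) ⊆ {y : EuclideanSpace ℝ (Fin 4) | 0 < y 0} → tsupport (f : EuclideanSpace ℝ (Fin 4) → ℝ) ⊆ Metric.closedBall (0 : EuclideanSpace ℝ (Fin 4)) R → tsupport (g : EuclideanSpace ℝ (Fin 4) → ℝ) ⊆ {y : EuclideanSpace ℝ (Fin 4) | 0 < y 0} → tsupport (g : EuclideanSpace ℝ (Fin 4) → ℝ) ⊆ Metric.closedBall (0 : EuclideanSpace ℝ (Fin 4)) R → R ≤ s * L → (∀ E : ℝ, 0 ≤ E → ∀ p : Fin 3 → ℝ, c * ‖LF s g E p‖ ≤ ‖LF s f E p‖) → ∀ Qf Qg : ℝ, Filter.Tendsto (fun k : ℕ => Qrp β (2 * L + 1) (2 ^ k * (2 * L + 1)) s f) Filter.atTop (nhds Qf) → Filter.Tendsto (fun k : ℕ => Qrp β (2 * L + 1) (2 ^ k * (2 * L + 1)) s g) Filter.atTop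 (nhds Qg) → c ^ 2 * Qg ≤ Qf

/-- **Registered stub `stub_thermalLimit` of crux 28192 HOLDS**: the thermal limit of the reflection form along the doubling
chain exists — `Theorems.SqueezedSkewnessThermalLimit.thermalLimit_proof` (item 22661). [cite: MontvayMunster1994, §3.2.6] -/
theorem stub_thermalLimit : ThermalLimit :=
  Summit.QuantumFields.YangMills.Theorems.SqueezedSkewnessThermalLimit.thermalLimit_proof

/-! ## Composition (verbatim from the birth skeleton) and the crux from its one remaining stub -/

/-- **VacuumDomination_of** — the skeleton's kernel-checked composition, verbatim: limits exist (S1), `ε ≤ Q_g`,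
`c² Q_g ≤ Q_f` (S2), so eventually `ε' < Qrp_k(f)`. -/
theorem VacuumDomination_of (hT : ThermalLimit) (hD : LimitDomination) :
    Summit.QuantumFields.YangMills.Theses.SqueezedSkewness.VacuumDomination := by
  intro G _ _ _ _ r
  have hT' := hT G r
  have hD' := hD G r
  dsimp only at hT' hD' ⊢
  intro β L s R c f g hβ hL hs hc hfpos hfR hgpos hgR hRL hdom ε ε' hε' hfloor
  obtain ⟨Qg, hTg⟩ := hT' β L s R g hβ hL hs hgpos hgR hRL
  obtain ⟨Qf, hTf⟩ := hT' β L s R f hβ hL hs hfpos hfR hRL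
  have hcmp : c ^ 2 * Qg ≤ Qf :=
    hD' β L s R c f g hβ hL hs hc hfpos hfR hgpos hgR hRL hdom Qf Qg hTf hTg
  have hεQg : ε ≤ Qg := by
    obtain ⟨k₀, hk⟩ := hfloor
    exact ge_of_tendsto hTg (Filter.eventually_atTop.2 ⟨k₀, hk⟩)
  have hlt : ε' < Qf := by
    have : c ^ 2 * ε ≤ c ^ 2 * Qg := mul_le_mul_of_nonneg_left hεQg (sq_nonneg c)
    linarith
  obtain ⟨k₀, hk⟩ := Filter.eventually_atTop.1 (hTf.eventually (eventually_gt_nhds hlt))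
  exact ⟨k₀, fun k hk' => (hk k hk').le⟩


/-- **The crux from its one remaining stub**: `LimitDomination → SqueezedSkewness.VacuumDomination`. -/
theorem vacuumDomination_of_limitDomination (hD : LimitDomination) :
    Summit.QuantumFields.YangMills.Theses.SqueezedSkewness.VacuumDomination :=
  VacuumDomination_of stub_thermalLimit hD

end Summit.QuantumFields.YangMills.Theorems.SqueezedSkewnessVacuumDominationStub
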